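import Summits.BirchSwinnertonDyer.Rank1Residual.P2.KrizLiTwoFortyThreeSlices
import Summits.BirchSwinnertonDyer.Rank1Residual.X12.CMIsogenyInvariance
import Literature.NumberTheory.EllipticCurves.Wuthrich2014.ShaBoundProofs
import HarnessLib

/-!
# Cell `bsd-print-cf2` (D-0131 (2) PRINT TIER, leaf CornerF @ `p = 2`), prover p3 — the Kriz–Li `243a1`
# slice on the whole `ℚ`-ISOGENY CLASS of each twist (Cassels' invariance and GZK are conjuncts of 𝔅_inert)

HONEST FRAMING. Companion of `P2/KrizLiTwoFortyThreeSlices.lean` (HONEST FRAMING there): the same slice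
— `BSD(W,2)` for the globally minimal models of the Kriz–Li twists `243a1^{(d)}`, `243a1^{(−23d)}`,
`d ∈ 𝒩`, `χ_d(−N) = 1` — extended to every `W` that is `ℚ`-ISOGENOUS to such a twist (so to the twists of
`243a2` as well), granted two more conjuncts of the crux bundle 𝔅_inert BY NAME: Cassels' isogeny
invariance (`bsdRHS_eq_of_isIsogenous`, tree consumer `Wuthrich2014.bsdp_of_isIsogenous`) and
Gross–Zagier–Kolyvagin (`rank_eq_analyticRank_of_analyticRank_le_one`, finiteness of `Ш` in analytic
rank `≤ 1`, the ranks being `1` / `0` by Kriz–Li Thm 4.3). Nothing class-wide is closed; no named fact is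
introduced; beyond print: YES as an assembly of printed theorems, NO as a method.

References: [KrizLi2019] Thm 5.1 (2), Thm 4.3, §6 Table 1 row 243a1; [MilneADT2006] Thm I.7.3 (Cassels);
[Darmon2004] Thm 3.22 (GZK); [SilvermanAEC2009] Cor. III.9.4; tree files cited inline.
-/

noncomputable section

open scoped Classical

open WeierstrassCurve NumberField Literature.NumberTheory.EllipticCurves
  Literature.NumberTheory.EllipticCurves.Rank1Residual
  Literature.NumberTheory.EllipticCurves.ModularForms
  Summit.BirchSwinnertonDyer.Rank1Residual

set_option autoImplicit false

namespace Summit.BirchSwinnertonDyer.Rank1Residual.P2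

/-! ## §10 The isogeny-class form (Cassels' invariance and GZK are conjuncts of 𝔅_inert) -/

/-- **`W` is `ℚ`-ISOGENOUS to a Kriz–Li twist of `243a1`**: `d ∈ 𝒩` with `χ_d(−N) = 1` and a
`ℚ`-isogeny `W ~ 243a1^{(d)}` or `W ~ 243a1^{(−23d)}` (contains every model of the twists of both curves
`243a1`, `243a2` of the class). A definition with a body (data `d`), not a named fact.
[cite: KrizLi2019, Def. 4.1 and Thm. 5.1 (2)] -/
def IsIsogenousToKrizLiTwoFortyThreeTwist (W : WeierstrassCurve ℚ) : Prop :=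
  ∃ d : ℤ, KrizLi2019.InN curve243a1 (sqrtField (-23)) d ∧
    Int.sign d * jacobiSym (curve243a1.conductorNorm ℤ) d.natAbs = 1 ∧
    (IsIsogenous W (curve243a1.quadraticTwist (d : ℚ)) ∨
      IsIsogenous W (curve243a1.quadraticTwist ((-23 * d : ℤ) : ℚ)))

/-- Models are isogenous (an isomorphism is an isogeny). [cite: SilvermanAEC2009, III.4] -/
theorem isIsogenousToKrizLiTwoFortyThreeTwist_of_isKrizLiTwoFortyThreeTwist {W : WeierstrassCurve ℚ}
    (hW : IsKrizLiTwoFortyThreeTwist W) : IsIsogenousToKrizLiTwoFortyThreeTwist W := by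
  obtain ⟨d, C, hd, hs, hC⟩ := hW
  exact ⟨d, hd, hs, hC.imp (fun h => isIsogenous_of_smul_eq' h) (fun h => isIsogenous_of_smul_eq' h)⟩

/-- **`BSD(W,2)` for every globally minimal `W` `ℚ`-ISOGENOUS to a Kriz–Li twist of `243a1`**: the twist
theorem on a globally minimal model of the twist, then Cassels' isogeny invariance (`hCassels`, tree
`Wuthrich2014.bsdp_of_isIsogenous`; `Ш` finite by Gross–Zagier–Kolyvagin `hGZK` in analytic rank `≤ 1`,
which Thm 4.3 supplies; `L^{(r)}(1) ≠ 0` by modularity). [cite: KrizLi2019, Thm. 5.1 (2) and Thm. 4.3]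
[cite: MilneADT2006, Thm. I.7.3] [cite: Miller2011LMS, §1 and Def. 1.1] -/
theorem bsdp_two_of_isIsogenous_twist_curve243a1 (hKL : KrizLi2019.thm112_bsdTwo_twist) (h33 : KrizLi2019.thm33_rank_twist)
    (htab : KrizLi2019.table1_row243a1) (hS31 : bsdTriple_of_analyticRank_le_one_of_conductor_lt)
    (hBF : bsdTriple_of_hasCM_of_L_one_ne_zero) (hmod : hasEntireLFunction_rat)
    (hGZK : rank_eq_analyticRank_of_analyticRank_le_one) (hCassels : bsdRHS_eq_of_isIsogenous)
    {d : ℤ} (hd : KrizLi2019.InN curve243a1 (sqrtField (-23)) d)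
    (hsign : Int.sign d * jacobiSym (curve243a1.conductorNorm ℤ) d.natAbs = 1)
    (W : WeierstrassCurve ℚ) [W.IsElliptic] [W.IsGloballyMinimal]
    (hiso : IsIsogenous W (curve243a1.quadraticTwist (d : ℚ)) ∨
      IsIsogenous W (curve243a1.quadraticTwist ((-23 * d : ℤ) : ℚ))) : BSDp W 2 := by
  haveI : Fact (2 : ℕ).Prime := ⟨Nat.prime_two⟩
  have hd0 : (d : ℚ) ≠ 0 := ne_zero_of_inN hd
  have hd0' : ((-23 * d : ℤ) : ℚ) ≠ 0 := by push_cast; exact mul_ne_zero (by norm_num) hd0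
  haveI := curve243a1.isElliptic_quadraticTwist hd0
  haveI := curve243a1.isElliptic_quadraticTwist hd0'
  obtain ⟨W₁, _, _, C₁, hC₁⟩ := P2.exists_globallyMinimal_twist curve243a1 hd0
  obtain ⟨W₂, _, _, C₂, hC₂⟩ := P2.exists_globallyMinimal_twist curve243a1 hd0'
  obtain ⟨hr1, hr2⟩ := analyticRank_of_twist_curve243a1 h33 htab hBF hmod hd hsign W₁ W₂ ⟨C₁, hC₁⟩ ⟨C₂, hC₂⟩
  rcases hiso with hiso | hiso
  · have hiso' : IsIsogenous W W₁ := hiso.trans' (by rw [← hC₁]; exact isIsogenous_smul _ C₁)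
    have hbsd := bsdp_two_of_twist_curve243a1 hKL h33 htab hS31 hBF hmod hd hsign W₁ (Or.inl ⟨C₁, hC₁⟩)
    exact Wuthrich2014.bsdp_of_isIsogenous hCassels hiso' (hGZK W₁ hr1.le).2
      (W₁.leadingLCoeff_ne_zero_holds (hmod W₁)) hbsd
  · have hiso' : IsIsogenous W W₂ := hiso.trans' (by rw [← hC₂]; exact isIsogenous_smul _ C₂)
    have hbsd := bsdp_two_of_twist_curve243a1 hKL h33 htab hS31 hBF hmod hd hsign W₂ (Or.inr ⟨C₂, hC₂⟩)
    exact Wuthrich2014.bsdp_of_isIsogenous hCassels hiso' (hGZK W₂ (by rw [hr2]; exact zero_le_one)).2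
      (W₂.leadingLCoeff_ne_zero_holds (hmod W₂)) hbsd

/-- **`BSD(W,2)` on the isogeny classes of the family, ENTIRELY BY NAME** (eight binders, all in
𝔅_inert ∪ {Thm 4.3, Table-1 row, Creutz–Miller}). [cite: KrizLi2019, Thm. 5.1 (2), Thm. 4.3, Table 1 row 243a1]
[cite: MilneADT2006, Thm. I.7.3] [cite: CreutzMiller2012, Thm. 1.1] [cite: BurungaleFlach2024, Cor. 2] -/
theorem bsdp_two_of_isIsogenousToKrizLiTwoFortyThreeTwist (hKL : KrizLi2019.thm112_bsdTwo_twist)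
    (h33 : KrizLi2019.thm33_rank_twist) (htab : KrizLi2019.table1_row243a1)
    (hS31 : bsdTriple_of_analyticRank_le_one_of_conductor_lt) (hBF : bsdTriple_of_hasCM_of_L_one_ne_zero)
    (hmod : hasEntireLFunction_rat) (hGZK : rank_eq_analyticRank_of_analyticRank_le_one)
    (hCassels : bsdRHS_eq_of_isIsogenous) (W : WeierstrassCurve ℚ) [W.IsElliptic] [W.IsGloballyMinimal]
    (hW : IsIsogenousToKrizLiTwoFortyThreeTwist W) : BSDp W 2 := by
  obtain ⟨d, hd, hsign, hiso⟩ := hW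
  exact bsdp_two_of_isIsogenous_twist_curve243a1 hKL h33 htab hS31 hBF hmod hGZK hCassels hd hsign W hiso

/-- **Placement of the isogeny classes** (unconditional): CM and `2` inert in the CM field (CM and the
CM field are isogeny invariants: tree `X12.hasCM_of_isIsogenous`, `X12.cmInert_iff_of_isIsogenous`).
[cite: SilvermanAEC2009, Cor. III.9.4] -/
theorem hasCM_and_cmInert_two_of_isIsogenousToKrizLiTwoFortyThreeTwist (W : WeierstrassCurve ℚ)
    [W.IsElliptic] (hW : IsIsogenousToKrizLiTwoFortyThreeTwist W) : W.HasCM ∧ CMInert W 2 := by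
  obtain ⟨d, hd, -, hiso⟩ := hW
  have hd0 : (d : ℚ) ≠ 0 := ne_zero_of_inN hd
  have hd0' : ((-23 * d : ℤ) : ℚ) ≠ 0 := by push_cast; exact mul_ne_zero (by norm_num) hd0
  have key : ∀ {e : ℚ}, e ≠ 0 → IsIsogenous W (curve243a1.quadraticTwist e) → W.HasCM ∧ CMInert W 2 := by
    intro e he hiso
    haveI := curve243a1.isElliptic_quadraticTwist he
    have h1 : (1 : VariableChange ℚ) • curve243a1.quadraticTwist e = curve243a1.quadraticTwist e :=
      one_smul _ _
    have hT : (curve243a1.quadraticTwist e).HasCM := hasCM_of_smul_twist_curve243a1 he h1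
    have hcmW : W.HasCM := X12.hasCM_of_isIsogenous hiso.symm_of_charZero hT
    exact ⟨hcmW, (X12.cmInert_iff_of_isIsogenous hiso hcmW 2).2 (cmInert_two_of_smul_twist_curve243a1 he h1)⟩
  rcases hiso with hiso | hiso
  · exact key hd0 hiso
  · exact key hd0' hiso

/-- **SLICE KL243-ISOGENY-CLASS BY NAME, in the binder shape of item 20363** (`… → ∀ W, W.HasCM →
W.analyticRank = 1 → CMInert W 2 → IsIsogenousToKrizLiTwoFortyThreeTwist W → BSDp W 2`), closed granted
`hKL h33 htab hS31 hBF hmod hGZK hCassels` (five of them conjuncts of 𝔅_inert). Beyond print: YES as an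
assembly of printed theorems, NO as a method. [cite: KrizLi2019, Thm. 5.1 (2), Thm. 4.3, §6 Table 1 row 243a1, Rem. 6.3]
[cite: CreutzMiller2012, Thm. 1.1] [cite: BurungaleFlach2024, Thm. 1.1 and Cor. 2] [cite: MilneADT2006, Thm. I.7.3] -/
theorem cornerFTwo_krizLiTwoFortyThree_isogenyClass_byName (hKL : KrizLi2019.thm112_bsdTwo_twist)
    (h33 : KrizLi2019.thm33_rank_twist) (htab : KrizLi2019.table1_row243a1)
    (hS31 : bsdTriple_of_analyticRank_le_one_of_conductor_lt) (hBF : bsdTriple_of_hasCM_of_L_one_ne_zero)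
    (hmod : hasEntireLFunction_rat) (hGZK : rank_eq_analyticRank_of_analyticRank_le_one)
    (hCassels : bsdRHS_eq_of_isIsogenous) :
    ∀ (W : WeierstrassCurve ℚ) [W.IsElliptic] [W.IsGloballyMinimal], W.HasCM → W.analyticRank = 1 →
      CMInert W 2 → IsIsogenousToKrizLiTwoFortyThreeTwist W → BSDp W 2 :=
  fun W _ _ _ _ _ hW =>
    bsdp_two_of_isIsogenousToKrizLiTwoFortyThreeTwist hKL h33 htab hS31 hBF hmod hGZK hCassels W hW

end Summit.BirchSwinnertonDyer.Rank1Residual.P2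

end
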